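import Summits.ValiantsHypothesis.ValiantsHypothesis.Theorems.LiftNullstellensatzLiftWidthPerFourCaseASection

/-!
# Route LiftNullstellensatz — `LiftWidthPerFour` (stmt-ValiantsHypothesis-5922), CASE A rung 1.75:
`ℓ, ℓ'` supported on the two rows and ONE column of the middle rows

Helper `--supports stmt-ValiantsHypothesis-5922` (prover val-width-5922-p2 g0).  First instance of the
section reduction `caseA_of_section_facts` (`…CaseASection.lean`): rows `0, 3`, and the middle-row
parts `λ = m·x_{10} + n·x_{20}`, `λ' = m'·x_{10} + n'·x_{20}` of `ℓ, ℓ'` supported on the column `0`.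
Then the rung-1 substitution `κ` (kill rows `0, 3` and column `0`) kills `λ, λ'`, the restricted
permanents are `(p₂₃, p₁₃, p₁₂)` themselves, and their engine facts are the rung-1 facts
`perm22_ne_zero`, `linSyzygy_eq_zero`, `quadSyzygy_koszul`, `eq_zero_of_perm_mul_eq_perm_mul`;
`λ = λ' = 0` is rung 1.5 (`caseA_twoRow`).  RESULT (`caseA_colZero`): CASE A holds for ALL `(ℓ, ℓ')`
supported on `{x_{0·}, x_{3·}, x_{10}, x_{20}}` — in the language of the crux workfile
(`CASEA-RUNG1-p2.md` v2 §6) the dependent AND independent pairs whose middle-row parts live on a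
single column (by the column symmetry of `per_4`, any column).  No new definitions.
VP ≠ VNP is not moved by this item.
-/

noncomputable section

open MvPolynomial Matrix Finset

namespace Summit.ValiantsHypothesis.LiftNullstellensatz

open Literature.Computability.AlgebraicComplexity

variable {K : Type*} [Field K]

/-- `C m · x_a + C n · x_b = 0` with `a ≠ b` forces `m = 0` (coefficient of `x_a`). [folklore] -/
theorem eq_zero_of_C_mul_X_add_C_mul_X_eq_zero {σ : Type*} {a b : σ} (hab : a ≠ b) {m n : K}
    (h : (C m * X a + C n * X b : MvPolynomial σ K) = 0) : m = 0 := by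
  classical
  have := congrArg (coeff (Finsupp.single a 1)) h
  simp only [coeff_add, coeff_C_mul, coeff_X, coeff_zero, if_true] at this
  rw [if_neg (fun e => hab (Finsupp.single_left_injective one_ne_zero e).symm)] at this
  simpa using this

/-- **CASE A, rung 1.75** (rows `0, 3`; `char K ≠ 2`): if the middle-row parts of `ℓ, ℓ'` are
supported on the column `0` — `ℓ = m x_{10} + n x_{20} + Σ α_j x_{0j} + Σ u_k x_{3k}`,
`ℓ' = m' x_{10} + n' x_{20} + Σ u'_j x_{0j} + Σ β_k x_{3k}`, any scalars — then `per_4` is not a sum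
of `b ≤ 5` products of quadrics `v_s ∈ (x_{0·}, ℓ)`, `v'_s ∈ (x_{3·}, ℓ')`.  (Section reduction with
the rung-1 substitution and the rung-1 engine facts; `m = n = m' = n' = 0` is `caseA_twoRow`.)
[cite: BlaserIkenmeyerMahajanPandeySaurabh2020, §2 (problem)] -/
theorem caseA_colZero (h2 : (2 : K) ≠ 0) (m n m' n' : K) (α u u' β : Fin 4 → K)
    (b : ℕ) (hb : b ≤ 5) (v v' : Fin b → MvPolynomial (Fin 4 × Fin 4) K)
    (hv : ∀ s, v s ∈ Ideal.span (insert
      ((C m * X (1, 0) + C n * X (2, 0)) + ∑ j, C (α j) * X (0, j) +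
        ∑ k, C (u k) * X (3, k) : MvPolynomial (Fin 4 × Fin 4) K)
      (Set.range fun j : Fin 4 => (X (0, j) : MvPolynomial (Fin 4 × Fin 4) K))))
    (hv2 : ∀ s, (v s).IsHomogeneous 2)
    (hv' : ∀ s, v' s ∈ Ideal.span (insert
      ((C m' * X (1, 0) + C n' * X (2, 0)) + ∑ j, C (u' j) * X (0, j) +
        ∑ k, C (β k) * X (3, k) : MvPolynomial (Fin 4 × Fin 4) K)
      (Set.range fun k : Fin 4 => (X (3, k) : MvPolynomial (Fin 4 × Fin 4) K))))
    (hv'2 : ∀ s, (v' s).IsHomogeneous 2) :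
    perPoly (Fin 4) K ≠ ∑ s, v s * v' s := by
  classical
  by_cases h0 : m = 0 ∧ n = 0 ∧ m' = 0 ∧ n' = 0
  · obtain ⟨rfl, rfl, rfl, rfl⟩ := h0
    simp only [map_zero, zero_mul, add_zero, zero_add] at hv hv'
    exact caseA_twoRow h2 b hb 0 3 (by decide) α u u' β v v' hv hv2 hv' hv'2
  -- the rung-1 substitution: kill rows 0, 3 and column 0
  let g : Fin 4 × Fin 4 → MvPolynomial (Fin 4 × Fin 4) K :=
    fun w => if w.1 = 0 ∨ w.1 = 3 ∨ w.2 = 0 then 0 else X w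
  let θ : MvPolynomial (Fin 4 × Fin 4) K →ₐ[K] MvPolynomial (Fin 4 × Fin 4) K := aeval g
  have hθX : ∀ w, θ (X w) = g w := fun w => aeval_X g w
  have hfix : ∀ r c : Fin 4, ¬(r = 0 ∨ r = 3 ∨ c = 0) → θ (X (r, c)) = X (r, c) := fun r c h => by
    rw [hθX]; exact if_neg h
  have hkill0 : ∀ j, θ (X (0, j)) = 0 := fun j => by rw [hθX]; exact if_pos (Or.inl rfl)
  have hkill3 : ∀ k, θ (X (3, k)) = 0 := fun k => by rw [hθX]; exact if_pos (Or.inr (Or.inl rfl))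
  have hkillc : ∀ r, θ (X (r, 0)) = 0 := fun r => by rw [hθX]; exact if_pos (Or.inr (Or.inr rfl))
  have h11 := hfix 1 1 (by decide); have h12 := hfix 1 2 (by decide); have h13 := hfix 1 3 (by decide)
  have h21 := hfix 2 1 (by decide); have h22 := hfix 2 2 (by decide); have h23 := hfix 2 3 (by decide)
  -- the middle-row parts as sums over the columns
  let μ : Fin 4 → K := fun c => if c = 0 then m else 0
  let ν : Fin 4 → K := fun c => if c = 0 then n else 0
  let μ' : Fin 4 → K := fun c => if c = 0 then m' else 0
  let ν' : Fin 4 → K := fun c => if c = 0 then n' else 0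
  have hsum : ∀ (a : K) (r : Fin 4), (∑ c, C ((fun c : Fin 4 => if c = 0 then a else 0) c) * X (r, c) :
      MvPolynomial (Fin 4 × Fin 4) K) = C a * X (r, 0) := fun a r => by
    rw [Fin.sum_univ_four]; simp
  have hlam : (∑ c, C (μ c) * X (1, c) + ∑ c, C (ν c) * X (2, c) : MvPolynomial (Fin 4 × Fin 4) K) =
      C m * X (1, 0) + C n * X (2, 0) := by rw [hsum, hsum]
  have hlam' : (∑ c, C (μ' c) * X (1, c) + ∑ c, C (ν' c) * X (2, c) : MvPolynomial (Fin 4 × Fin 4) K) =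
      C m' * X (1, 0) + C n' * X (2, 0) := by rw [hsum, hsum]
  have hnd : (∑ c, C (μ c) * X (1, c) + ∑ c, C (ν c) * X (2, c) : MvPolynomial (Fin 4 × Fin 4) K) ≠ 0 ∨
      (∑ c, C (μ' c) * X (1, c) + ∑ c, C (ν' c) * X (2, c) : MvPolynomial (Fin 4 × Fin 4) K) ≠ 0 := by
    rw [hlam, hlam']
    by_contra hcon
    push Not at hcon
    obtain ⟨e, e'⟩ := hcon
    have h12ne : ((1 : Fin 4), (0 : Fin 4)) ≠ ((2 : Fin 4), (0 : Fin 4)) := by decide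
    have hm := eq_zero_of_C_mul_X_add_C_mul_X_eq_zero h12ne e
    have hn := eq_zero_of_C_mul_X_add_C_mul_X_eq_zero h12ne.symm (by rw [add_comm]; exact e)
    have hm' := eq_zero_of_C_mul_X_add_C_mul_X_eq_zero h12ne e'
    have hn' := eq_zero_of_C_mul_X_add_C_mul_X_eq_zero h12ne.symm (by rw [add_comm]; exact e')
    exact h0 ⟨hm, hn, hm', hn'⟩
  rw [← hlam] at hv
  rw [← hlam'] at hv'
  refine caseA_of_section_facts θ (fun w => ?_) hkill0 hkill3 hkillc μ ν μ' ν' α u u' β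
    (by rw [hlam]; simp [map_add, map_mul, hkillc]) (by rw [hlam']; simp [map_add, map_mul, hkillc]) hnd
    ![X (1, 2) * X (2, 3) + X (1, 3) * X (2, 2), X (1, 1) * X (2, 3) + X (1, 3) * X (2, 1),
      X (1, 1) * X (2, 2) + X (1, 2) * X (2, 1)]
    (by simp [map_add, map_mul, h12, h13, h22, h23]) (by simp [map_add, map_mul, h11, h13, h21, h23])
    (by simp [map_add, map_mul, h11, h12, h21, h22]) (perm22_ne_zero 2 3 (by decide))
    (fun l₀ l₁ l₂ hl₀ hl₁ hl₂ h => linSyzygy_eq_zero h2 l₀ l₁ l₂ hl₀ hl₁ hl₂ h)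
    (fun n₀ n₁ n₂ hn₀ hn₁ hn₂ h => quadSyzygy_koszul h2 n₀ n₁ n₂ hn₀ hn₁ hn₂ h)
    (fun f g' hf hg h => (eq_zero_of_perm_mul_eq_perm_mul (k := 1) (b := 2) (d := 3) (by decide)
      (by decide) (by decide) f g' hf hg h).2)
    b hb v v' hv hv2 hv' hv'2
  -- the substitution is by linear forms (or zero)
  rw [hθX]
  by_cases h : w.1 = 0 ∨ w.1 = 3 ∨ w.2 = 0
  · simp only [g, if_pos h]; exact isHomogeneous_zero _ _ _
  · simp only [g, if_neg h]; exact isHomogeneous_X K w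

end Summit.ValiantsHypothesis.LiftNullstellensatz

end
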